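import Literature.AlgebraicGeometry.Motives.IntegralModelRestrictScalarsAway
import HarnessLib

/-!
# Morphism properties of a LOCALISED integral model (`𝒳 ⊗_A R → Spec R` inherits them from `𝒳 → Spec A`)

Topic `Literature/AlgebraicGeometry/Motives`; namespace `Literature.AlgebraicGeometry.Motives.IntegralModel`.  Theorems only (no `def`,
no instance, no notation, no named fact, no `sorry`).  Cell `hodgecm-mathlib`, P6 «MOD programme», sub-desk P6a, GEN layer — organ
«LOCALISE-PROPS» (A-p03 (g29); the «G3 binders» left open by the INT-RES family ★ `IntegralModelRestrictScalars*`): the heart letters of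
`Lines/F0_P6a_ModuliDatum` quantify over the LOCALISATION `𝓜.localise w` of a global integral model, and the sheet ∕ semilinear theorems
of the INT-RES family carry instance binders `[Flat ((restrictScalarsOfIntermediate hinj 𝓜).localise w).total.hom]`,
`[IsSeparated …]`, `[QuasiCompact …]`; this file discharges every such binder from the corresponding GLOBAL instance on the model,
in one line each.  HC_CM is proved only modulo the printed citations until rung 0 closes; nothing here is about HC.

THE MATHEMATICS ([GortzWedhorn2020] Prop. 4.16, §(4.8), Prop. 4.32, App. C; [StacksProject] Tags 01K5, 01KU, 01T4, 01TS, 01U9, 01W4,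
01VB; [SerreTate1968] §1).  The localised model `𝒳.localiseAt R` has total space `𝒳.total ×_{Spec A} Spec R` with structure morphism
the second projection `pullback.snd 𝒳.total.hom (Spec R → Spec A)` (★ `localiseAt_total`, `rfl`).  Each of the properties
quasi-compact, quasi-separated, locally of finite type, locally of finite presentation, flat, separated, universally closed, proper,
smooth of relative dimension `n` is stable under base change (Mathlib's `MorphismProperty.IsStableUnderBaseChange` instances), hence
passes from `𝒳.total.hom` to `(𝒳.localiseAt R).total.hom` (Mathlib `MorphismProperty.baseChange_obj`, the pattern of ★
`isProper_reduction`); in particular `IsSmoothProper n` localises.  §2 reads these at `R = 𝒪_{F,(w)}` (`localise w`), and §3 ∕ §4 at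
the restricted models `restrictScalarsOfIntermediate hinj 𝓜` (`𝓞 L ⊆ B ⊆ L`, e.g. `B = 𝓞 L[1∕N]`) and `restrictScalarsRingOfIntegers 𝓜`,
composing with the ★ EQV-SPREAD binders of `IntegralModelRestrictScalarsAway` ∕ `IntegralModelRestrictScalars`.

MAIN STATEMENTS.  §1 `quasiCompact_ ∕ quasiSeparated_ ∕ locallyOfFiniteType_ ∕ locallyOfFinitePresentation_ ∕ flat_ ∕ isSeparated_ ∕
universallyClosed_ ∕ isProper_ ∕ smoothOfRelativeDimension_localiseAt_total_hom`, **`IsSmoothProper.localiseAt`**; §2 the same nine for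
`localise w`, **`IsSmoothProper.localise`**; §3 **`flat_ ∕ isSeparated_ ∕ quasiCompact_ ∕ quasiSeparated_ ∕
locallyOfFinitePresentation_localise_restrictScalarsOfIntermediate`** (+ `_of_away`); §4 `flat_ ∕ isSeparated_ ∕ isProper_ ∕ quasiCompact_ ∕
quasiSeparated_ ∕ locallyOfFinitePresentation_localise_restrictScalarsRingOfIntegers`, `IsSmoothProper` is NOT automatic here (it is the
cofinite hypothesis `h𝓨` of the letters, ★ `eventually_isSmoothProper_localise`).

## References
* [GortzWedhorn2020] U. Görtz, T. Wedhorn, *Algebraic Geometry I* (2nd ed.), Prop. 4.16, §(4.8), Prop. 4.32, Appendix C (permanence of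
  properties of morphisms under base change).
* [StacksProject] The Stacks Project, Tags 01K5 (quasi-compact), 01KU (quasi-separated ∕ separated), 01T4 (finite type), 01TS (finite
  presentation), 01U9 (flat), 01W4 (universally closed ∕ proper), 01VB (smooth): stability under base change.
* [SerreTate1968] J.-P. Serre, J. Tate, *Good reduction of abelian varieties*, Ann. of Math. 88 (1968), §1 (models and their localisations).
-/

set_option autoImplicit false

noncomputable section

set_option backward.isDefEq.respectTransparency false

open CategoryTheory CategoryTheory.Limits AlgebraicGeometry IsDedekindDomain
open scoped NumberField nonZeroDivisors

namespace Literature.AlgebraicGeometry.Motives.IntegralModel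

/-! ### §1 Any localisation `𝒳.localiseAt R` along `A → R → K` -/

section LocaliseAt

variable {A K : Type} [CommRing A] [Field K] [Algebra A K] {X : SchemeOver K} (𝒳 : IntegralModel A K X)
  (R : Type) [CommRing R] [Algebra A R] [Algebra R K] [IsScalarTower A R K]

/-- Quasi-compactness localises. [cite: StacksProject, Tag 01K5] [cite: GortzWedhorn2020, Prop. 4.32 and Appendix C] -/
theorem quasiCompact_localiseAt_total_hom [QuasiCompact 𝒳.total.hom] : QuasiCompact (𝒳.localiseAt R).total.hom :=
  MorphismProperty.baseChange_obj _ _ ‹_›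

/-- Quasi-separatedness localises. [cite: StacksProject, Tag 01KU] [cite: GortzWedhorn2020, Prop. 4.32 and Appendix C] -/
theorem quasiSeparated_localiseAt_total_hom [QuasiSeparated 𝒳.total.hom] : QuasiSeparated (𝒳.localiseAt R).total.hom :=
  MorphismProperty.baseChange_obj _ _ ‹_›

/-- Local finite type localises. [cite: StacksProject, Tag 01T4] [cite: GortzWedhorn2020, Prop. 4.32 and Appendix C] -/
theorem locallyOfFiniteType_localiseAt_total_hom [LocallyOfFiniteType 𝒳.total.hom] :
    LocallyOfFiniteType (𝒳.localiseAt R).total.hom :=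
  MorphismProperty.baseChange_obj _ _ ‹_›

/-- Local finite presentation localises. [cite: StacksProject, Tag 01TS] [cite: GortzWedhorn2020, Prop. 4.32 and Appendix C] -/
theorem locallyOfFinitePresentation_localiseAt_total_hom [LocallyOfFinitePresentation 𝒳.total.hom] :
    LocallyOfFinitePresentation (𝒳.localiseAt R).total.hom :=
  MorphismProperty.baseChange_obj _ _ ‹_›

/-- Flatness localises. [cite: StacksProject, Tag 01U9] [cite: GortzWedhorn2020, Prop. 4.32 and Appendix C] -/
theorem flat_localiseAt_total_hom [Flat 𝒳.total.hom] : Flat (𝒳.localiseAt R).total.hom :=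
  MorphismProperty.baseChange_obj _ _ ‹_›

/-- Separatedness localises. [cite: StacksProject, Tag 01KU] [cite: GortzWedhorn2020, Prop. 4.32 and Appendix C] -/
theorem isSeparated_localiseAt_total_hom [IsSeparated 𝒳.total.hom] : IsSeparated (𝒳.localiseAt R).total.hom :=
  MorphismProperty.baseChange_obj _ _ ‹_›

/-- Universal closedness localises. [cite: StacksProject, Tag 01W4] [cite: GortzWedhorn2020, Prop. 4.32 and Appendix C] -/
theorem universallyClosed_localiseAt_total_hom [UniversallyClosed 𝒳.total.hom] : UniversallyClosed (𝒳.localiseAt R).total.hom :=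
  MorphismProperty.baseChange_obj _ _ ‹_›

/-- Properness localises. [cite: StacksProject, Tag 01W4] [cite: GortzWedhorn2020, Prop. 4.32 and Appendix C] -/
theorem isProper_localiseAt_total_hom [IsProper 𝒳.total.hom] : IsProper (𝒳.localiseAt R).total.hom :=
  MorphismProperty.baseChange_obj _ _ ‹_›

/-- Smoothness of relative dimension `n` localises. [cite: StacksProject, Tag 01VB] [cite: GortzWedhorn2020, Prop. 4.32 and Appendix C] -/
theorem smoothOfRelativeDimension_localiseAt_total_hom (n : ℕ) [SmoothOfRelativeDimension n 𝒳.total.hom] :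
    SmoothOfRelativeDimension n (𝒳.localiseAt R).total.hom :=
  haveI := smoothOfRelativeDimension_isStableUnderBaseChange (n := n)
  MorphismProperty.baseChange_obj _ _ ‹_›

/-- **Good reduction localises**: a model smooth and proper of relative dimension `n` over `A` is so over every `R` between `A` and `K`.
[cite: SerreTate1968, §1] [cite: GortzWedhorn2020, Prop. 4.32 and Appendix C] -/
theorem IsSmoothProper.localiseAt {n : ℕ} (h : 𝒳.IsSmoothProper n) : (𝒳.localiseAt R).IsSmoothProper n :=
  haveI := h.1; haveI := h.2
  ⟨smoothOfRelativeDimension_localiseAt_total_hom 𝒳 R n, isProper_localiseAt_total_hom 𝒳 R⟩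

end LocaliseAt

/-! ### §2 The localisation `𝒳.localise w` at a prime `w` of a number field -/

section Localise

variable {F : Type} [Field F] [NumberField F] {X : SchemeOver F} (𝒳 : IntegralModel (𝓞 F) F X) (w : HeightOneSpectrum (𝓞 F))

/-- Quasi-compactness localises at `w`. [cite: StacksProject, Tag 01K5] [cite: SerreTate1968, §1] -/
theorem quasiCompact_localise_total_hom [QuasiCompact 𝒳.total.hom] : QuasiCompact (𝒳.localise w).total.hom :=
  quasiCompact_localiseAt_total_hom 𝒳 _

/-- Quasi-separatedness localises at `w`. [cite: StacksProject, Tag 01KU] [cite: SerreTate1968, §1] -/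
theorem quasiSeparated_localise_total_hom [QuasiSeparated 𝒳.total.hom] : QuasiSeparated (𝒳.localise w).total.hom :=
  quasiSeparated_localiseAt_total_hom 𝒳 _

/-- Local finite type localises at `w`. [cite: StacksProject, Tag 01T4] [cite: SerreTate1968, §1] -/
theorem locallyOfFiniteType_localise_total_hom [LocallyOfFiniteType 𝒳.total.hom] : LocallyOfFiniteType (𝒳.localise w).total.hom :=
  locallyOfFiniteType_localiseAt_total_hom 𝒳 _

/-- Local finite presentation localises at `w`. [cite: StacksProject, Tag 01TS] [cite: SerreTate1968, §1] -/
theorem locallyOfFinitePresentation_localise_total_hom [LocallyOfFinitePresentation 𝒳.total.hom] :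
    LocallyOfFinitePresentation (𝒳.localise w).total.hom :=
  locallyOfFinitePresentation_localiseAt_total_hom 𝒳 _

/-- Flatness localises at `w`. [cite: StacksProject, Tag 01U9] [cite: SerreTate1968, §1] -/
theorem flat_localise_total_hom [Flat 𝒳.total.hom] : Flat (𝒳.localise w).total.hom :=
  flat_localiseAt_total_hom 𝒳 _

/-- Separatedness localises at `w`. [cite: StacksProject, Tag 01KU] [cite: SerreTate1968, §1] -/
theorem isSeparated_localise_total_hom [IsSeparated 𝒳.total.hom] : IsSeparated (𝒳.localise w).total.hom :=
  isSeparated_localiseAt_total_hom 𝒳 _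

/-- Universal closedness localises at `w`. [cite: StacksProject, Tag 01W4] [cite: SerreTate1968, §1] -/
theorem universallyClosed_localise_total_hom [UniversallyClosed 𝒳.total.hom] : UniversallyClosed (𝒳.localise w).total.hom :=
  universallyClosed_localiseAt_total_hom 𝒳 _

/-- Properness localises at `w`. [cite: StacksProject, Tag 01W4] [cite: SerreTate1968, §1] -/
theorem isProper_localise_total_hom [IsProper 𝒳.total.hom] : IsProper (𝒳.localise w).total.hom :=
  isProper_localiseAt_total_hom 𝒳 _

/-- Smoothness of relative dimension `n` localises at `w`. [cite: StacksProject, Tag 01VB] [cite: SerreTate1968, §1] -/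
theorem smoothOfRelativeDimension_localise_total_hom (n : ℕ) [SmoothOfRelativeDimension n 𝒳.total.hom] :
    SmoothOfRelativeDimension n (𝒳.localise w).total.hom :=
  smoothOfRelativeDimension_localiseAt_total_hom 𝒳 _ n

/-- **Good reduction everywhere localises at every `w`** (the cofinite statement for a general model is ★ `eventually_isSmoothProper_localise`).
[cite: SerreTate1968, §1] -/
theorem IsSmoothProper.localise {n : ℕ} (h : 𝒳.IsSmoothProper n) : (𝒳.localise w).IsSmoothProper n :=
  h.localiseAt 𝒳 _

end Localise

/-! ### §3 The localised restricted model `(restrictScalarsOfIntermediate hinj 𝓜).localise w` (`𝓞 L ⊆ B ⊆ L`) -/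

section Intermediate

variable {F L : Type} [Field F] [NumberField F] [Field L] [NumberField L] [Algebra F L]
  {B : Type} [CommRing B] [Algebra (𝓞 L) B] [Algebra B L] [IsScalarTower (𝓞 L) B L]
  [Algebra (𝓞 F) B] [IsScalarTower (𝓞 F) B L] {Z : SchemeOver L}

/-- The binder `[QuasiCompact ((restrictScalarsOfIntermediate hinj 𝓜).localise w).total.hom]`, from `[QuasiCompact 𝓜.total.hom]`.
[cite: GortzWedhorn2020, Prop. 4.16 and §(4.8)] -/
theorem quasiCompact_localise_restrictScalarsOfIntermediate (hinj : Function.Injective (algebraMap B L)) (𝓜 : IntegralModel B L Z)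
    [QuasiCompact 𝓜.total.hom] (w : HeightOneSpectrum (𝓞 F)) :
    QuasiCompact ((restrictScalarsOfIntermediate (F := F) hinj 𝓜).localise w).total.hom :=
  haveI := quasiCompact_restrictScalarsOfIntermediate (F := F) hinj 𝓜
  quasiCompact_localise_total_hom _ w

/-- The binder `[QuasiSeparated ((restrictScalarsOfIntermediate hinj 𝓜).localise w).total.hom]`, from `[QuasiSeparated 𝓜.total.hom]`.
[cite: GortzWedhorn2020, Prop. 4.16 and §(4.8)] -/
theorem quasiSeparated_localise_restrictScalarsOfIntermediate (hinj : Function.Injective (algebraMap B L)) (𝓜 : IntegralModel B L Z)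
    [QuasiSeparated 𝓜.total.hom] (w : HeightOneSpectrum (𝓞 F)) :
    QuasiSeparated ((restrictScalarsOfIntermediate (F := F) hinj 𝓜).localise w).total.hom :=
  haveI := quasiSeparated_restrictScalarsOfIntermediate (F := F) hinj 𝓜
  quasiSeparated_localise_total_hom _ w

/-- The binder `[IsSeparated ((restrictScalarsOfIntermediate hinj 𝓜).localise w).total.hom]` of the ★ SEMILIN ∕ SEMILIN-SHEETS theorems
(`genericFibre_map_localiseMap_semilinearHomOf`, `sheetAt_comp_isoMk_aut`, …), from `[IsSeparated 𝓜.total.hom]`.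
[cite: GortzWedhorn2020, Prop. 4.16 and §(4.8)] -/
theorem isSeparated_localise_restrictScalarsOfIntermediate (hinj : Function.Injective (algebraMap B L)) (𝓜 : IntegralModel B L Z)
    [IsSeparated 𝓜.total.hom] (w : HeightOneSpectrum (𝓞 F)) :
    IsSeparated ((restrictScalarsOfIntermediate (F := F) hinj 𝓜).localise w).total.hom :=
  haveI := isSeparated_restrictScalarsOfIntermediate (F := F) hinj 𝓜
  isSeparated_localise_total_hom _ w

/-- The binder `[Flat ((restrictScalarsOfIntermediate hinj 𝓜).localise w).total.hom]` of the ★ SEMILIN ∕ SEMILIN-SHEETS ∕ THICKENING theorems,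
from `[Flat 𝓜.total.hom]` and `B` flat over `𝓞 L`. [cite: SerreTate1968, §1] [cite: GortzWedhorn2020, Prop. 4.16 and §(4.8)] -/
theorem flat_localise_restrictScalarsOfIntermediate [IsScalarTower (𝓞 F) (𝓞 L) B] (hinj : Function.Injective (algebraMap B L))
    (𝓜 : IntegralModel B L Z) [Module.Flat (𝓞 L) B] [Flat 𝓜.total.hom] (w : HeightOneSpectrum (𝓞 F)) :
    Flat ((restrictScalarsOfIntermediate (F := F) hinj 𝓜).localise w).total.hom :=
  haveI := flat_restrictScalarsOfIntermediate (F := F) hinj 𝓜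
  flat_localise_total_hom _ w

/-- The binder `[LocallyOfFinitePresentation ((restrictScalarsOfIntermediate hinj 𝓜).localise w).total.hom]`, from
`[LocallyOfFinitePresentation 𝓜.total.hom]` and `B` finitely presented over `𝓞 L`. [cite: SerreTate1968, §1]
[cite: GortzWedhorn2020, Prop. 4.16 and §(4.8)] -/
theorem locallyOfFinitePresentation_localise_restrictScalarsOfIntermediate [IsScalarTower (𝓞 F) (𝓞 L) B]
    (hinj : Function.Injective (algebraMap B L)) (𝓜 : IntegralModel B L Z)
    [Algebra.FinitePresentation (𝓞 L) B] [LocallyOfFinitePresentation 𝓜.total.hom] (w : HeightOneSpectrum (𝓞 F)) :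
    LocallyOfFinitePresentation ((restrictScalarsOfIntermediate (F := F) hinj 𝓜).localise w).total.hom :=
  haveI := locallyOfFinitePresentation_restrictScalarsOfIntermediate (F := F) hinj 𝓜
  locallyOfFinitePresentation_localise_total_hom _ w

/-- The AWAY case `B = 𝓞 L[1∕x]` of the flatness binder. [cite: SerreTate1968, §1] -/
theorem flat_localise_restrictScalarsOfIntermediate_of_away [IsScalarTower (𝓞 F) (𝓞 L) B] (x : 𝓞 L) [IsLocalization.Away x B]
    (hinj : Function.Injective (algebraMap B L)) (𝓜 : IntegralModel B L Z) [Flat 𝓜.total.hom] (w : HeightOneSpectrum (𝓞 F)) :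
    Flat ((restrictScalarsOfIntermediate (F := F) hinj 𝓜).localise w).total.hom :=
  haveI := flat_restrictScalarsOfIntermediate_of_away (F := F) x hinj 𝓜
  flat_localise_total_hom _ w

/-- The AWAY case `B = 𝓞 L[1∕x]` of the finite-presentation binder. [cite: SerreTate1968, §1] -/
theorem locallyOfFinitePresentation_localise_restrictScalarsOfIntermediate_of_away [IsScalarTower (𝓞 F) (𝓞 L) B] (x : 𝓞 L)
    [IsLocalization.Away x B] (hinj : Function.Injective (algebraMap B L)) (𝓜 : IntegralModel B L Z)
    [LocallyOfFinitePresentation 𝓜.total.hom] (w : HeightOneSpectrum (𝓞 F)) :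
    LocallyOfFinitePresentation ((restrictScalarsOfIntermediate (F := F) hinj 𝓜).localise w).total.hom :=
  haveI := locallyOfFinitePresentation_restrictScalarsOfIntermediate_of_away (F := F) x hinj 𝓜
  locallyOfFinitePresentation_localise_total_hom _ w

end Intermediate

/-! ### §4 The localised restricted model `(restrictScalarsRingOfIntegers 𝓜).localise w` (`B = 𝓞 Fᵢ`) -/

section RingOfIntegers

variable {F Fi : Type} [Field F] [NumberField F] [Field Fi] [NumberField Fi] [Algebra F Fi] {Z : SchemeOver Fi}
  (𝓜 : IntegralModel (𝓞 Fi) Fi Z) (w : HeightOneSpectrum (𝓞 F))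

/-- Quasi-compactness of the localised model viewed over `𝓞 F`. [cite: GortzWedhorn2020, Prop. 4.16 and §(4.8)] -/
theorem quasiCompact_localise_restrictScalarsRingOfIntegers [QuasiCompact 𝓜.total.hom] :
    QuasiCompact ((restrictScalarsRingOfIntegers (F := F) 𝓜).localise w).total.hom :=
  haveI := quasiCompact_restrictScalarsRingOfIntegers (F := F) 𝓜
  quasiCompact_localise_total_hom _ w

/-- Quasi-separatedness of the localised model viewed over `𝓞 F`. [cite: GortzWedhorn2020, Prop. 4.16 and §(4.8)] -/
theorem quasiSeparated_localise_restrictScalarsRingOfIntegers [QuasiSeparated 𝓜.total.hom] :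
    QuasiSeparated ((restrictScalarsRingOfIntegers (F := F) 𝓜).localise w).total.hom :=
  haveI := quasiSeparated_restrictScalarsRingOfIntegers (F := F) 𝓜
  quasiSeparated_localise_total_hom _ w

/-- Local finite presentation of the localised model viewed over `𝓞 F` (`𝓞 Fᵢ` is finitely presented over `𝓞 F`). [cite: SerreTate1968, §1]
[cite: GortzWedhorn2020, Prop. 4.16 and §(4.8)] -/
theorem locallyOfFinitePresentation_localise_restrictScalarsRingOfIntegers [LocallyOfFinitePresentation 𝓜.total.hom] :
    LocallyOfFinitePresentation ((restrictScalarsRingOfIntegers (F := F) 𝓜).localise w).total.hom :=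
  haveI := locallyOfFinitePresentation_restrictScalarsRingOfIntegers (F := F) 𝓜
  locallyOfFinitePresentation_localise_total_hom _ w

/-- Flatness of the localised model viewed over `𝓞 F` (`𝓞 Fᵢ` is flat over the Dedekind domain `𝓞 F`). [cite: SerreTate1968, §1]
[cite: GortzWedhorn2020, Prop. 4.16 and §(4.8)] -/
theorem flat_localise_restrictScalarsRingOfIntegers [Flat 𝓜.total.hom] :
    Flat ((restrictScalarsRingOfIntegers (F := F) 𝓜).localise w).total.hom :=
  haveI := flat_restrictScalarsRingOfIntegers (F := F) 𝓜
  flat_localise_total_hom _ w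

/-- Separatedness of the localised model viewed over `𝓞 F`. [cite: GortzWedhorn2020, Prop. 4.16 and §(4.8)] -/
theorem isSeparated_localise_restrictScalarsRingOfIntegers [IsSeparated 𝓜.total.hom] :
    IsSeparated ((restrictScalarsRingOfIntegers (F := F) 𝓜).localise w).total.hom :=
  haveI := isSeparated_restrictScalarsRingOfIntegers (F := F) 𝓜
  isSeparated_localise_total_hom _ w

/-- Properness of the localised model viewed over `𝓞 F` (`Spec 𝓞 Fᵢ → Spec 𝓞 F` is finite, hence proper). [cite: SerreTate1968, §1]
[cite: GortzWedhorn2020, Prop. 4.16 and §(4.8)] -/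
theorem isProper_localise_restrictScalarsRingOfIntegers [IsProper 𝓜.total.hom] :
    IsProper ((restrictScalarsRingOfIntegers (F := F) 𝓜).localise w).total.hom :=
  haveI := isProper_restrictScalarsRingOfIntegers (F := F) 𝓜
  isProper_localise_total_hom _ w

end RingOfIntegers

end Literature.AlgebraicGeometry.Motives.IntegralModel
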